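import Mathlib
import Literature.MathematicalPhysics.QuantumFieldTheory.OSReconstructionNoE1Proofs
import Literature.MathematicalPhysics.QuantumFieldTheory.OSJointSpectralMeasureUniqueness
import Literature.Analysis.FunctionSpaces.TranslationInvariantDistribution
import HarnessLib

/-!
# Universal two-point measure, I: superposed one-point field vectors (line `complex-rotation-bandlimit`)

Support file for crux `stmt-QuantumFields-11686` (`PencilRigidity.NPointIsotropy`), stub
`universalTwoPointMeasure` (roadmap R2, groundwork for the degree-one doubled orbit kernel).
Setting: a one-species Schwinger family `S₁` on `ℝ⁴` with `h : OSReconstructionNoE1 S₁.toLabelled`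
(reflection positivity along `e₀` and translation invariance on `⁰𝒮`), its OS Hilbert space, the
one-point field vectors `Ψ_g = h.fieldVec 1 _ g _` of positive-time `g`, the contraction semigroup
`e^{-tH} = h.transfer t` and the unitary spatial translations `U(a⃗) = h.translate a`.

* One-point test functions are handled through `𝓢(ℝ⁴) ≅ 𝓢((ℝ⁴)¹)`
  (`SchwartzMap.compCLMOfContinuousLinearEquiv` along `ContinuousLinearEquiv.funUnique`).
* `transfer_translate_fieldVec` — `e^{-a⁰H} U(a⃗) Ψ_g = Ψ_{g(· − a)}` for `a⁰ ≥ 0`; the vector-valued map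
  `a ↦ e^{-a⁰H} U(a⃗) ψ` is continuous and bounded by `‖ψ‖`, so Schwartz-weighted superpositions
  `∫ w(a) e^{-a⁰H} U(a⃗) Ψ_g da` are Bochner integrals.
* `fieldVec_translationAverage_eq_integral` — **superposition**: for a Schwartz weight `w` vanishing
  on `{a⁰ < 0}`, `Ψ_{w ∗ g} = ∫ w(a) e^{-a⁰H} U(a⃗) Ψ_g da`, where `w ∗ g = ∫ w(a) g(· − a) da` is the
  tree's averaging operator `SchwartzAverage.translationAverage`. Proof: test against the total set
  of generator vectors, `⟪Ψ_F, Ψ_G⟫ = 𝔖(ΘF* ⊗ G)`, and exchange the tempered distribution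
  `G ↦ 𝔖(ΘF* ⊗ G)` with the weighted average of translates
  (`SchwartzAverage.integral_mul_apply_compSubConstCLM`).

References: K. Osterwalder, R. Schrader, Comm. Math. Phys. 31 (1973) §4.1 and 42 (1975) Ch. V
(5.3)–(5.4); J. Glimm, A. Jaffe, Quantum Physics (1987) §6.1. [folklore]
-/

noncomputable section

namespace Summit.QuantumFields.YangMills.Theorems.NPointIsotropy.ComplexRotationBandlimit

open MeasureTheory Complex Set Filter Topology
open scoped InnerProductSpace ComplexConjugate SchwartzMap ENNReal NNReal
open Literature.MathematicalPhysics.QuantumLattice Literature.MathematicalPhysics.AQFT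
  Literature.MathematicalPhysics.QuantumFieldTheory
open Literature.Analysis.FunctionSpaces Literature.Analysis.FunctionSpaces.SchwartzAverage

namespace UniversalTwoPoint

/-! ## One-point test functions: `𝓢(ℝ⁴) ≅ 𝓢((ℝ⁴)¹)` -/

/-- Values of `toOne`. [folklore] -/
@[simp] theorem toOne_apply (u : 𝓢((EuclideanSpace ℝ (Fin 4)), ℂ)) (x : Fin 1 → (EuclideanSpace ℝ (Fin 4))) : ((SchwartzMap.compCLMOfContinuousLinearEquiv ℂ (ContinuousLinearEquiv.funUnique (Fin 1) ℝ (EuclideanSpace ℝ (Fin 4)))) u) x = u (x 0) := by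
  rw [SchwartzMap.compCLMOfContinuousLinearEquiv_apply]; rfl

/-- Values of `ofOne`. [folklore] -/
@[simp] theorem ofOne_apply (f : 𝓢((Fin 1 → (EuclideanSpace ℝ (Fin 4))), ℂ)) (a : (EuclideanSpace ℝ (Fin 4))) : ((SchwartzMap.compCLMOfContinuousLinearEquiv ℂ (ContinuousLinearEquiv.symm (ContinuousLinearEquiv.funUnique (Fin 1) ℝ (EuclideanSpace ℝ (Fin 4))))) f) a = f (fun _ => a) := by
  rw [SchwartzMap.compCLMOfContinuousLinearEquiv_apply]; rfl

/-- `toOne ∘ ofOne = id`. [folklore] -/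
@[simp] theorem toOne_ofOne (f : 𝓢((Fin 1 → (EuclideanSpace ℝ (Fin 4))), ℂ)) : (SchwartzMap.compCLMOfContinuousLinearEquiv ℂ (ContinuousLinearEquiv.funUnique (Fin 1) ℝ (EuclideanSpace ℝ (Fin 4)))) ((SchwartzMap.compCLMOfContinuousLinearEquiv ℂ (ContinuousLinearEquiv.symm (ContinuousLinearEquiv.funUnique (Fin 1) ℝ (EuclideanSpace ℝ (Fin 4))))) f) = f := by
  ext x
  rw [toOne_apply, ofOne_apply]
  congr 1
  funext i
  rw [Subsingleton.elim i 0]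

/-- `ofOne ∘ toOne = id`. [folklore] -/
@[simp] theorem ofOne_toOne (u : 𝓢((EuclideanSpace ℝ (Fin 4)), ℂ)) : (SchwartzMap.compCLMOfContinuousLinearEquiv ℂ (ContinuousLinearEquiv.symm (ContinuousLinearEquiv.funUnique (Fin 1) ℝ (EuclideanSpace ℝ (Fin 4))))) ((SchwartzMap.compCLMOfContinuousLinearEquiv ℂ (ContinuousLinearEquiv.funUnique (Fin 1) ℝ (EuclideanSpace ℝ (Fin 4)))) u) = u := by
  ext a
  rw [ofOne_apply, toOne_apply]

/-- Translating a one-point test function: `(toOne u)(· − a) = toOne (u(· − a))`. [folklore] -/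
theorem translateMulti_toOne (a : (EuclideanSpace ℝ (Fin 4))) (u : 𝓢((EuclideanSpace ℝ (Fin 4)), ℂ)) :
    translateMulti a ((SchwartzMap.compCLMOfContinuousLinearEquiv ℂ (ContinuousLinearEquiv.funUnique (Fin 1) ℝ (EuclideanSpace ℝ (Fin 4)))) u) = (SchwartzMap.compCLMOfContinuousLinearEquiv ℂ (ContinuousLinearEquiv.funUnique (Fin 1) ℝ (EuclideanSpace ℝ (Fin 4)))) (SchwartzMap.compSubConstCLM ℂ a u) := by
  ext x
  rw [translateMulti_apply, toOne_apply, toOne_apply, SchwartzMap.compSubConstCLM_apply]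

/-- A one-point test function supported in `{x⁰ ≥ δ}`, `δ > 0`, is time-ordered. [folklore] -/
theorem isTimeOrdered_of_forall_le {F : 𝓢((Fin 1 → (EuclideanSpace ℝ (Fin 4))), ℂ)} {δ : ℝ} (hδ : 0 < δ)
    (hF : ∀ x, F x ≠ 0 → δ ≤ x 0 0) : IsTimeOrdered F := by
  have hcl : IsClosed {x : Fin 1 → (EuclideanSpace ℝ (Fin 4)) | δ ≤ x 0 0} :=
    isClosed_le continuous_const ((PiLp.continuous_apply 2 _ 0).comp (continuous_apply 0))
  have hsub : tsupport (F : (Fin 1 → (EuclideanSpace ℝ (Fin 4))) → ℂ) ⊆ {x : Fin 1 → (EuclideanSpace ℝ (Fin 4)) | δ ≤ x 0 0} :=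
    closure_minimal (fun x hx => hF x hx) hcl
  intro x hx
  have h0 : δ ≤ x 0 0 := hsub hx
  refine ⟨fun i => ?_, fun i j hij => ?_⟩
  · rw [Subsingleton.elim i 0]; linarith
  · exact absurd (Subsingleton.elim i j) (ne_of_lt hij)

/-- On the support of a time-ordered one-point test function the time is positive. [folklore] -/
theorem pos_of_isTimeOrdered {F : 𝓢((Fin 1 → (EuclideanSpace ℝ (Fin 4))), ℂ)} (hF : IsTimeOrdered F) {x : Fin 1 → (EuclideanSpace ℝ (Fin 4))}
    (hx : F x ≠ 0) : 0 < x 0 0 :=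
  (hF (subset_closure hx)).1 0

/-- The weight read off a time-ordered one-point function vanishes on `{a⁰ ≤ 0}`. [folklore] -/
theorem pos_of_ofOne_ne_zero {f : 𝓢((Fin 1 → (EuclideanSpace ℝ (Fin 4))), ℂ)} (hf : IsTimeOrdered f) {a : (EuclideanSpace ℝ (Fin 4))}
    (ha : ((SchwartzMap.compCLMOfContinuousLinearEquiv ℂ (ContinuousLinearEquiv.symm (ContinuousLinearEquiv.funUnique (Fin 1) ℝ (EuclideanSpace ℝ (Fin 4))))) f) a ≠ 0) : 0 < a 0 := by
  rw [ofOne_apply] at ha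
  exact pos_of_isTimeOrdered hf ha

/-! ## Translated one-point field vectors `e^{-a⁰H} U(a⃗) Ψ_g` -/

variable {S₁ : SchwingerFamily (EuclideanSpace ℝ (Fin 4))} (h : OSReconstructionNoE1 S₁.toLabelled)

/-- Field vectors of equal test functions agree. [folklore] -/
theorem fieldVec_congr' {n : ℕ} {F G : 𝓢((Fin n → (EuclideanSpace ℝ (Fin 4))), ℂ)} (hFG : F = G) (hF : IsTimeOrdered F)
    (hG : IsTimeOrdered G) : h.fieldVec n (fun _ => ()) F hF = h.fieldVec n (fun _ => ()) G hG := by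
  subst hFG; rfl

/-- `a = a⁰ e₀ + a⃗`. [folklore] -/
theorem timeVec_add_spatialPart (a : (EuclideanSpace ℝ (Fin 4))) : SchwingerFamily.timeVec (a 0) + spatialPart 0 a = a := by
  ext i
  simp only [SchwingerFamily.timeVec, PiLp.add_apply, PiLp.single_apply, spatialPart_apply]
  split_ifs with hi
  · subst hi; simp
  · simp

/-- **`e^{-a⁰H} U(a⃗) Ψ_g = Ψ_{g(· − a)}`** for `a⁰ ≥ 0`. [folklore] -/
theorem transfer_translate_fieldVec {n : ℕ} {g : 𝓢((Fin n → (EuclideanSpace ℝ (Fin 4))), ℂ)} (hg : IsTimeOrdered g) {a : (EuclideanSpace ℝ (Fin 4))}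
    (ha : 0 ≤ a 0) :
    h.transfer (a 0) (h.translate a (h.fieldVec n (fun _ => ()) g hg)) =
      h.fieldVec n (fun _ => ()) (translateMulti a g)
        (OSReconstructionNoE1.isTimeOrdered_translateMulti hg ha) := by
  rw [h.translate_fieldVec, h.transfer_fieldVec ha]
  refine fieldVec_congr' h ?_ _ _
  rw [translateMulti_translateMulti, timeVec_add_spatialPart]

/-- `‖e^{-a⁰H} U(a⃗) ψ‖ ≤ ‖ψ‖`. [folklore] -/
theorem norm_transfer_translate_le (ψ : h.Hilbert) (a : (EuclideanSpace ℝ (Fin 4))) :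
    ‖h.transfer (a 0) (h.translate a ψ)‖ ≤ ‖ψ‖ :=
  (h.norm_transfer_le _ _).trans (le_of_eq ((h.translate a).norm_map ψ))

/-- **Continuity of `a ↦ e^{-a⁰H} U(a⃗) ψ`** (strong continuity of both factors and `‖e^{-tH}‖ ≤ 1`).
[folklore] -/
theorem continuous_transfer_translate (ψ : h.Hilbert) :
    Continuous fun a : (EuclideanSpace ℝ (Fin 4)) => h.transfer (a 0) (h.translate a ψ) := by
  refine continuous_iff_continuousAt.2 fun a₀ => ?_
  rw [ContinuousAt, tendsto_iff_norm_sub_tendsto_zero]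
  have hb : ∀ a : (EuclideanSpace ℝ (Fin 4)), ‖h.transfer (a 0) (h.translate a ψ) - h.transfer (a₀ 0) (h.translate a₀ ψ)‖ ≤
      ‖h.translate a ψ - h.translate a₀ ψ‖ +
        ‖h.transfer (a 0) (h.translate a₀ ψ) - h.transfer (a₀ 0) (h.translate a₀ ψ)‖ := by
    intro a
    calc ‖h.transfer (a 0) (h.translate a ψ) - h.transfer (a₀ 0) (h.translate a₀ ψ)‖
        = ‖h.transfer (a 0) (h.translate a ψ - h.translate a₀ ψ) +
            (h.transfer (a 0) (h.translate a₀ ψ) - h.transfer (a₀ 0) (h.translate a₀ ψ))‖ := by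
          rw [map_sub]; congr 1; abel
      _ ≤ ‖h.transfer (a 0) (h.translate a ψ - h.translate a₀ ψ)‖ +
            ‖h.transfer (a 0) (h.translate a₀ ψ) - h.transfer (a₀ 0) (h.translate a₀ ψ)‖ :=
          norm_add_le _ _
      _ ≤ _ := by gcongr; exact h.norm_transfer_le _ _
  refine squeeze_zero (fun a => norm_nonneg _) hb ?_
  rw [← zero_add (0 : ℝ)]
  refine Tendsto.add ?_ ?_
  · have h1 := (h.continuous_translate_apply ψ).tendsto a₀
    rwa [tendsto_iff_norm_sub_tendsto_zero] at h1
  · have hc : Continuous fun a : (EuclideanSpace ℝ (Fin 4)) => h.transfer (a 0) (h.translate a₀ ψ) :=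
      (h.continuous_transfer_apply _).comp (PiLp.continuous_apply 2 _ 0)
    have h1 := hc.tendsto a₀
    rwa [tendsto_iff_norm_sub_tendsto_zero] at h1

/-- A Schwartz-weighted family of translated vectors is Bochner integrable. [folklore] -/
theorem integrable_smul_transfer_translate (w : 𝓢((EuclideanSpace ℝ (Fin 4)), ℂ)) (ψ : h.Hilbert) :
    Integrable fun a : (EuclideanSpace ℝ (Fin 4)) => w a • h.transfer (a 0) (h.translate a ψ) := by
  refine (w.integrable.norm.mul_const ‖ψ‖).mono'
    ((w.continuous.smul (continuous_transfer_translate h ψ)).aestronglyMeasurable)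
    (Eventually.of_forall fun a => ?_)
  rw [norm_smul]
  exact mul_le_mul_of_nonneg_left (norm_transfer_translate_le h ψ a) (norm_nonneg _)

/-! ## Superposition: `Ψ_{w ∗ g} = ∫ w(a) e^{-a⁰H} U(a⃗) Ψ_g da` -/

/-- Matrix elements of translated one-point field vectors against generator vectors:
`⟪Ψ_p, e^{-a⁰H}U(a⃗)Ψ_g⟫ = 𝔖_{m+1}(ΘF_p* ⊗ g(· − a))`, `a⁰ ≥ 0`. [folklore] -/
theorem inner_genVec_transfer_translate_fieldVec (p : OSReconstructionNoE1.Gen Unit 4)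
    {g : 𝓢((Fin 1 → (EuclideanSpace ℝ (Fin 4))), ℂ)} (hg : IsTimeOrdered g) {a : (EuclideanSpace ℝ (Fin 4))} (ha : 0 ≤ a 0) :
    ⟪h.genVec p, h.transfer (a 0) (h.translate a (h.fieldVec 1 (fun _ => ()) g hg))⟫_ℂ =
      S₁ (p.deg + 1) ((osAdjoint p.fn).appendTensor (translateMulti a g)) := by
  rw [transfer_translate_fieldVec h hg ha, OSReconstructionNoE1.fieldVec_eq_genVec,
    OSReconstructionNoE1.inner_genVec_genVec]
  rfl

/-- **Superposed one-point field vectors.** For `u, w ∈ 𝓢(ℝ⁴)` with `toOne u` time-ordered and the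
weight `w` vanishing on `{a⁰ < 0}`: if the averaged translate `w ∗ u = ∫ w(a) u(· − a) da` is
time-ordered (as a one-point function), then `Ψ_{w ∗ u} = ∫ w(a) e^{-a⁰H} U(a⃗) Ψ_u da`. [folklore] -/
theorem fieldVec_translationAverage_eq_integral {u w : 𝓢((EuclideanSpace ℝ (Fin 4)), ℂ)} (hg : IsTimeOrdered ((SchwartzMap.compCLMOfContinuousLinearEquiv ℂ (ContinuousLinearEquiv.funUnique (Fin 1) ℝ (EuclideanSpace ℝ (Fin 4)))) u))
    (hw : ∀ a, w a ≠ 0 → 0 ≤ a 0)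
    (hK : IsTimeOrdered ((SchwartzMap.compCLMOfContinuousLinearEquiv ℂ (ContinuousLinearEquiv.funUnique (Fin 1) ℝ (EuclideanSpace ℝ (Fin 4)))) (translationAverage (ContinuousLinearMap.id ℝ (EuclideanSpace ℝ (Fin 4))) w u))) :
    h.fieldVec 1 (fun _ => ()) ((SchwartzMap.compCLMOfContinuousLinearEquiv ℂ (ContinuousLinearEquiv.funUnique (Fin 1) ℝ (EuclideanSpace ℝ (Fin 4)))) (translationAverage (ContinuousLinearMap.id ℝ (EuclideanSpace ℝ (Fin 4))) w u)) hK =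
      ∫ a, w a • h.transfer (a 0) (h.translate a (h.fieldVec 1 (fun _ => ()) ((SchwartzMap.compCLMOfContinuousLinearEquiv ℂ (ContinuousLinearEquiv.funUnique (Fin 1) ℝ (EuclideanSpace ℝ (Fin 4)))) u) hg)) := by
  set vG : (EuclideanSpace ℝ (Fin 4)) → h.Hilbert := fun a =>
    h.transfer (a 0) (h.translate a (h.fieldVec 1 (fun _ => ()) ((SchwartzMap.compCLMOfContinuousLinearEquiv ℂ (ContinuousLinearEquiv.funUnique (Fin 1) ℝ (EuclideanSpace ℝ (Fin 4)))) u) hg)) with hvG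
  have hint : Integrable (fun a => w a • vG a) := integrable_smul_transfer_translate h w _
  refine (ext_inner_left ℂ fun z => ?_).symm
  revert z
  have hclosed : IsClosed {z : h.Hilbert | ⟪z, ∫ a, w a • vG a⟫_ℂ =
      ⟪z, h.fieldVec 1 (fun _ => ())
        ((SchwartzMap.compCLMOfContinuousLinearEquiv ℂ (ContinuousLinearEquiv.funUnique (Fin 1) ℝ (EuclideanSpace ℝ (Fin 4)))) (translationAverage (ContinuousLinearMap.id ℝ (EuclideanSpace ℝ (Fin 4))) w u)) hK⟫_ℂ} :=
    isClosed_eq (continuous_id.inner continuous_const) (continuous_id.inner continuous_const)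
  refine fun z => h.denseRange_vec.induction_on z hclosed fun v => ?_
  induction v using Finsupp.induction_linear with
  | zero =>
      change ⟪h.vec 0, _⟫_ℂ = ⟪h.vec 0, _⟫_ℂ
      rw [map_zero, inner_zero_left, inner_zero_left]
  | add v₁ v₂ h₁ h₂ =>
      change ⟪h.vec (v₁ + v₂), _⟫_ℂ = ⟪h.vec (v₁ + v₂), _⟫_ℂ
      rw [map_add, inner_add_left, inner_add_left, h₁, h₂]
  | single p c =>
      change ⟪h.vec (Finsupp.single p c), _⟫_ℂ = ⟪h.vec (Finsupp.single p c), _⟫_ℂ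
      rw [← Finsupp.smul_single_one p c, map_smul, inner_smul_left, inner_smul_left]
      congr 1
      change ⟪h.genVec p, _⟫_ℂ = ⟪h.genVec p, _⟫_ℂ
      obtain ⟨m, lab, F, hF⟩ := p
      -- the tempered distribution `H ↦ 𝔖_{m+1}(ΘF* ⊗ toOne H)` on `𝓢(ℝ⁴)`
      let T : 𝓢((EuclideanSpace ℝ (Fin 4)), ℂ) →L[ℂ] ℂ :=
        { toFun := fun H => S₁ (m + 1) ((osAdjoint F).appendTensor ((SchwartzMap.compCLMOfContinuousLinearEquiv ℂ (ContinuousLinearEquiv.funUnique (Fin 1) ℝ (EuclideanSpace ℝ (Fin 4)))) H))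
          map_add' := fun H H' => by
            rw [map_add, SchwartzMap.appendTensor_add_right, map_add]
          map_smul' := fun c H => by
            rw [map_smul, SchwartzMap.appendTensor_smul_right, map_smul]; rfl
          cont := (S₁ (m + 1)).continuous.comp ((continuous_appendTensor.comp
            (continuous_const.prodMk continuous_id)).comp
              (SchwartzMap.compCLMOfContinuousLinearEquiv ℂ _).continuous) }
      have hT : ∀ H : 𝓢((EuclideanSpace ℝ (Fin 4)), ℂ), T H = S₁ (m + 1) ((osAdjoint F).appendTensor ((SchwartzMap.compCLMOfContinuousLinearEquiv ℂ (ContinuousLinearEquiv.funUnique (Fin 1) ℝ (EuclideanSpace ℝ (Fin 4)))) H)) :=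
        fun H => rfl
      rw [← integral_inner hint]
      have hpt : (fun a => ⟪h.genVec ⟨m, lab, F, hF⟩, w a • vG a⟫_ℂ) = fun a =>
          w a * T (SchwartzMap.compSubConstCLM ℂ ((ContinuousLinearMap.id ℝ (EuclideanSpace ℝ (Fin 4))) a) u) := by
        funext a
        rw [inner_smul_right]
        by_cases hwa : w a = 0
        · rw [hwa, zero_mul, zero_mul]
        · rw [hvG, inner_genVec_transfer_translate_fieldVec h _ hg (hw a hwa), hT,
            ContinuousLinearMap.id_apply, translateMulti_toOne]
      rw [hpt, integral_mul_apply_compSubConstCLM (ContinuousLinearMap.id ℝ (EuclideanSpace ℝ (Fin 4))) w T u, hT,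
        OSReconstructionNoE1.fieldVec_eq_genVec, OSReconstructionNoE1.inner_genVec_genVec]
      rfl

end UniversalTwoPoint

/-- **Superposed one-point field vectors** (closed form of
`UniversalTwoPoint.fieldVec_translationAverage_eq_integral`, the registered sub-goal of this support file):
`Ψ_{w ∗ u} = ∫ w(a) e^{-a⁰H} U(a⃗) Ψ_u da` for a Schwartz weight `w` vanishing on `{a⁰ < 0}`. [folklore] -/
theorem fieldVec_translationAverage_superposition : ∀ (S₁ : Literature.MathematicalPhysics.QuantumLattice.SchwingerFamily (EuclideanSpace ℝ (Fin 4))) (h : Literature.MathematicalPhysics.QuantumFieldTheory.OSReconstructionNoE1 S₁.toLabelled) (u w : SchwartzMap (EuclideanSpace ℝ (Fin 4)) ℂ) (hg : Literature.MathematicalPhysics.QuantumLattice.IsTimeOrdered (SchwartzMap.compCLMOfContinuousLinearEquiv ℂ (ContinuousLinearEquiv.funUnique (Fin 1) ℝ (EuclideanSpace ℝ (Fin 4))) u)), (∀ a : EuclideanSpace ℝ (Fin 4), w a ≠ 0 → 0 ≤ a 0) → ∀ (hK : Literature.MathematicalPhysics.QuantumLattice.IsTimeOrdered (SchwartzMap.compCLMOfContinuousLinearEquiv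 ℂ (ContinuousLinearEquiv.funUnique (Fin 1) ℝ (EuclideanSpace ℝ (Fin 4))) (Literature.Analysis.FunctionSpaces.SchwartzAverage.translationAverage (ContinuousLinearMap.id ℝ (EuclideanSpace ℝ (Fin 4))) w u))), h.fieldVec 1 (fun _ => ()) (SchwartzMap.compCLMOfContinuousLinearEquiv ℂ (ContinuousLinearEquiv.funUnique (Fin 1) ℝ (EuclideanSpace ℝ (Fin 4))) (Literature.Analysis.FunctionSpaces.SchwartzAverage.translationAverage (ContinuousLinearMap.id ℝ (EuclideanSpace ℝ (Fin 4))) w u)) hK = ∫ a : EuclideanSpace ℝ (Fin 4), w a • h.transfer (a 0) (h.translate a (h.fieldVec 1 (fun _ => ()) (SchwartzMap.compCLMOfContinuousLinearEquiv ℂ (ContinuousLinearEquiv.funUnique (Fin 1) ℝ (EuclideanSpace ℝ (Fin 4))) u) hg)) :=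
  fun _ h _ _ hg hw hK => UniversalTwoPoint.fieldVec_translationAverage_eq_integral h hg hw hK

end Summit.QuantumFields.YangMills.Theorems.NPointIsotropy.ComplexRotationBandlimit

end
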